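import Mathlib.Analysis.SpecialFunctions.Trigonometric.Inverse
import Mathlib.Analysis.SpecialFunctions.Sqrt
import Literature.MathematicalPhysics.QuantumLattice.FieldAxisZeemanPeierlsBrackets
import HarnessLib

/-!
# The body-centred inter-layer one-band form `E_z(k) = −2 t_z cos(k_z c/2) (cos kₓ − cos k_y)² cos(kₓ/2) cos(k_y/2)`:
# exact form-factor identities, the sharp Brillouin-zone maximum `64/(25√5)`, and CODATA brackets for the
# measured inter-layer members of the La-214 / Tl-2201 / Hg-1201 / NCCO validation boxes

The Hubbard-branch parameter boxes of cell hubbard-downfold carry an inter-layer row «tperp/t (M)»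
(FS-average / FS-maximum / BZ-maximum of the `k_z`-bandwidth `W_z(k∥)/4t` of the one-band Wannier band, or
the largest direct inter-plane element) and a dimensionality descriptor D9 («quasi-2D iff tperp/t
(FS-average) ≤ 0.05»).  In the body-centred-tetragonal single-layer cuprates (La₂₋ₓSrₓCuO₄, Nd₂₋ₓCeₓCuO₄,
Tl₂Ba₂CuO₆₊δ) ONE printed form of the inter-layer term is used by the LDA tight-binding fit
[MarkiewiczEtAl2005, Eq. (7)–(8): `E_z = −2 t_z c_z(c/2) (cₓ(a) − c_y(a))² S_xy`, `S_xy = cₓ(a/2) c_y(a/2)`,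
"S_xy vanishes for in-plane momenta along (π,0) → (π,π), leading to a lack of k_z-dispersion along this high
symmetry line"], by the soft-x-ray ARPES `k_z` fit [HorioEtAl2018LSCO3DFermiSurface, Eq. (3): `t_z = 0.07 t`
for La₁.₇₈Sr₀.₂₂CuO₄ and Eu-LSCO, `< 0.015 t` for Tl-2201; Table I] and by the ADMR Boltzmann fit
[GrissonnancheEtAl2021PlanckianADMR, Eq. (5) and Extended Data Table 1: `t_z/t = 0.0651 ± 0.0005` for Nd-LSCO
`p = 0.24`].  This file types that form with unit lattice constants (`a = 1`, layer spacing `c/2 = 1/2`, so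
the `k_z` factor is `cos(k_z/2)`):

* §1 `bctInterlayer tz kx ky kz = −2 tz cos(kz/2) (cos kx − cos ky)² cos(kx/2) cos(ky/2)`; it VANISHES on the
  nodal lines `cos kx = cos ky` (`bctInterlayer_nodal`) and on the zone faces `kx = π`, `ky = π`
  (`bctInterlayer_face_x/_y`) — the printed symmetry statements; `|E_z| ≤ 2|t_z|·g(k∥) ≤ 8|t_z|` with the
  in-plane form factor `g = |cos(kx/2) cos(ky/2)| (cos kx − cos ky)²` (`formFactor`), and the `k_z`-BANDWIDTH
  at fixed `k∥` is exactly `4|t_z|·g(k∥)` (`bctInterlayer_kz_zero_sub_two_pi`, `abs_sub_le_bandwidth`): the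
  dictionary from the measured AMPLITUDE `t_z` to the boxes' `W_z/4t = |t_z/t|·g` objects.
* §2 the SHARP zone maximum: in half-angle variables `g = 4|uv|(u² − v²)²`, `u = cos(kx/2)`, `v = cos(ky/2)`
  (`formFactor_eq_halfAngle`), and `4|uv|(u² − v²)² ≤ 64/(25√5)` on `[-1,1]²` (`quartic_le_bound`) via the
  elementary factorisation `16 − w(5 − w²)² = (w − 1)²(16 + 7w − 2w² − w³)` on `0 ≤ w ≤ √5`; hence
  `formFactor kx ky ≤ 64/(25√5)` (`formFactor_le`) with EQUALITY at `ky = 0`, `cos(kx/2) = 1/√5`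
  (`formFactor_sharp`), and the bracket `1.1448 < 64/(25√5) < 1.1449` (`bzMaxConst_bracket`).  So the BZ-maximum
  object is `W_z,max/4t = (64/(25√5))·|t_z/t|`: images `0.0745…` (ADMR 0.0651), `0.0801…` (ARPES 0.07),
  `0.1373…` (LDA 0.12), `< 0.0172` (Tl-2201 bound) (`bzMaxImage_*`) — brackets only; the FS-AVERAGE images of
  REFVALS-2 §110.1 need the in-plane band and are NOT typed here.
* §3 CODATA arithmetic for the quantum-oscillation members: `ħω_c = ħeB/m* = 2 μ_B B/(m*/m_e)`
  (`cyclotronQuantum`; `μ_B = eħ/2m_e` from `FieldAxisDictionary.muB`) with the NCCO reading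
  `2.516 meV < ħω_c(20 T, 0.92 m_e) < 2.518 meV` [KartsovnikEtAl2011NCCOFermiSurface, p. 14–15: "ħω_c …
  exceeds the interlayer dispersion at fields B ≳ 20 T", `m_c/m_e = 0.92 ± 0.05`]; and Chan–Harrison et al.'s
  warping bound `2ΔF_c ≈ 4 t⊥ m*/(ħe)` ⇒ `t⊥ = μ_B ΔF_c/(m*/m_e)` (`warpingHopping`) with
  `0.3430 meV < t⊥(16 T, 2.7) < 0.3431 meV < 0.35 meV` and `t⊥/t < 10⁻³` at `t = 460 meV`
  [ChanEtAl2016Hg1201SinglePocket, p. 3 and Methods: "ΔF_c < 16 T … t⊥ < 0.35 meV … at least 1000 times smaller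
  than the nearest neighbor hopping"].
* §4 the located La-214 members as named constants with their measured/bare ratios
  `0.54 < 0.0651/0.12`, `0.07/0.12 < 0.59` (Horio: "1.7 times larger"), and the κ-(ET)₂Cu(NCS)₂ h8/d8
  inter-layer isotope pair `t_a = 0.065 ± 0.007 / 0.045 ± 0.005 meV` [GoddardEtAl2004KappaNCSAMRO, Fig. 16]
  with the worst-case ratio bracket `1.16 ≤ t_a(h8)/t_a(d8) ≤ 1.8`.

Everything is a definition with a body or a proved theorem: no facts, no axioms beyond Mathlib's, no
`sorry`.  Not here: the in-plane band, Fermi-surface averages, any statement about which orbital carries the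
inter-layer hopping, and the multi-term NCCO / bilayer Bi-2212 forms of [MarkiewiczEtAl2005, Eqs. (9)–(13)].

References: R. S. Markiewicz, S. Sahrakorpi, M. Lindroos, H. Lin, A. Bansil, Phys. Rev. B 72, 054519 (2005),
arXiv:cond-mat/0503064 · M. Horio et al., Phys. Rev. Lett. 121, 077004 (2018), arXiv:1804.08019 ·
G. Grissonnanche et al., Nature 595, 667 (2021), arXiv:2011.13054 · Y. Fang et al., Nat. Phys. 18, 558 (2022),
arXiv:2004.01725 · M. K. Chan et al., Nat. Commun. 7, 12244 (2016), arXiv:1606.02772 · M. V. Kartsovnik et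
al., New J. Phys. 13, 015001 (2011), arXiv:1104.1165 · P. A. Goddard et al., Phys. Rev. B 69, 174509 (2004),
arXiv:cond-mat/0312197 · P. J. Mohr et al., CODATA 2022.  AI-produced formalisation (H21, cell
hubbard-downfold, seat lit-2 g25, 2026-08-29); companion of REFVALS-2 §110.
-/

namespace Literature.MathematicalPhysics.QuantumLattice.BctInterlayer

noncomputable section

open Real
open Literature.MathematicalPhysics.QuantumLattice.FieldAxisDictionary (muB muB_pos)

/-! ## §1 The form, its zeros and its `k_z`-bandwidth -/

/-- The body-centred staggering factor `S_xy = cos(kₓ a/2) cos(k_y a/2)` (here `a = 1`), which "accounts for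
the presence of the … layer offset" by `(a/2, a/2)` between successive CuO₂ planes.
[cite: MarkiewiczEtAl2005, Eq. (8)] -/
def stagger (kx ky : ℝ) : ℝ := cos (kx / 2) * cos (ky / 2)

/-- The `(cos kₓ − cos k_y)²` factor of the inter-layer term ("arises from the hybridization between O 2p and
Cu 4s or 3d_{3z²−r²} orbitals that promote hopping along the c-axis").
[cite: HorioEtAl2018LSCO3DFermiSurface, Eq. (3) and the sentence after it] -/
def dsq (kx ky : ℝ) : ℝ := (cos kx - cos ky) ^ 2

/-- **The body-centred inter-layer one-band term** `E_z(k) = −2 t_z cos(k_z c/2) (cos kₓa − cos k_ya)² cos(kₓa/2) cos(k_ya/2)`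
with `a = 1`, `c/2 ↦ 1/2`. [cite: MarkiewiczEtAl2005, Eq. (7); GrissonnancheEtAl2021PlanckianADMR, Eq. (5)] -/
def bctInterlayer (tz kx ky kz : ℝ) : ℝ :=
  -2 * tz * cos (kz / 2) * dsq kx ky * stagger kx ky

/-- Unfolding of `bctInterlayer`. [cite: MarkiewiczEtAl2005, Eq. (7)] -/
theorem bctInterlayer_def (tz kx ky kz : ℝ) :
    bctInterlayer tz kx ky kz
      = -2 * tz * cos (kz / 2) * (cos kx - cos ky) ^ 2 * (cos (kx / 2) * cos (ky / 2)) := rfl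

/-- The in-plane FORM FACTOR `g(k∥) = |cos(kₓ/2) cos(k_y/2)| (cos kₓ − cos k_y)²` that multiplies `|t_z|` in every
box object (`W_z(k∥) = 4|t_z| g(k∥)`). [cite: MarkiewiczEtAl2005, Eq. (7)–(8)] -/
def formFactor (kx ky : ℝ) : ℝ := |stagger kx ky| * dsq kx ky

/-- `g ≥ 0`. [cite: MarkiewiczEtAl2005, Eq. (7)–(8)] -/
theorem formFactor_nonneg (kx ky : ℝ) : 0 ≤ formFactor kx ky := by
  unfold formFactor dsq; positivity

/-- **No `k_z` dispersion on the nodal lines** `cos kₓ = cos k_y` (in particular along `Γ → (π,π)`): "No k_z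
dispersion is observed along the nodal direction". [cite: HorioEtAl2018LSCO3DFermiSurface, abstract and Eq. (3)] -/
theorem bctInterlayer_nodal (tz kx ky kz : ℝ) (h : cos kx = cos ky) :
    bctInterlayer tz kx ky kz = 0 := by
  simp [bctInterlayer, dsq, h]

/-- **No `k_z` dispersion on the zone face `kₓ = π`** (the line `(π,0) → (π,π)`): "S_xy vanishes for in-plane
momenta along (π, 0) → (π, π), leading to a lack of k_z-dispersion along this high symmetry line".
[cite: MarkiewiczEtAl2005, text after Eq. (8)] -/
theorem bctInterlayer_face_x (tz ky kz : ℝ) : bctInterlayer tz π ky kz = 0 := by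
  simp [bctInterlayer, stagger, Real.cos_pi_div_two]

/-- The same on the face `k_y = π`. [cite: MarkiewiczEtAl2005, text after Eq. (8)] -/
theorem bctInterlayer_face_y (tz kx kz : ℝ) : bctInterlayer tz kx π kz = 0 := by
  simp [bctInterlayer, stagger, Real.cos_pi_div_two]

/-- At `k_z = 0` the term is `−2 t_z g̃(k∥)` with the SIGNED form factor `g̃ = (cos kₓ − cos k_y)² cos(kₓ/2)cos(k_y/2)`.
[cite: MarkiewiczEtAl2005, Eq. (7)] -/
theorem bctInterlayer_kz_zero (tz kx ky : ℝ) :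
    bctInterlayer tz kx ky 0 = -2 * tz * dsq kx ky * stagger kx ky := by
  simp [bctInterlayer]

/-- At `k_z = 2π` (i.e. `k_z c/2 = π`) the term is `+2 t_z g̃(k∥)`. [cite: MarkiewiczEtAl2005, Eq. (7)] -/
theorem bctInterlayer_kz_two_pi (tz kx ky : ℝ) :
    bctInterlayer tz kx ky (2 * π) = 2 * tz * dsq kx ky * stagger kx ky := by
  have h : (2 * π) / 2 = π := by ring
  simp [bctInterlayer, h]

/-- **Pointwise bound** `|E_z(k)| ≤ 2 |t_z| g(k∥)` for every `k_z` (`|cos| ≤ 1`).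
[cite: MarkiewiczEtAl2005, Eq. (7)] -/
theorem abs_bctInterlayer_le (tz kx ky kz : ℝ) :
    |bctInterlayer tz kx ky kz| ≤ 2 * |tz| * formFactor kx ky := by
  unfold bctInterlayer formFactor dsq
  have hc : |cos (kz / 2)| ≤ 1 := abs_cos_le_one _
  have hsq : 0 ≤ (cos kx - cos ky) ^ 2 := sq_nonneg _
  rw [show -2 * tz * cos (kz / 2) * (cos kx - cos ky) ^ 2 * stagger kx ky
        = (-2) * (tz * (cos (kz / 2) * ((cos kx - cos ky) ^ 2 * stagger kx ky))) by ring]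
  rw [abs_mul, abs_mul, abs_mul, abs_mul, abs_of_nonneg hsq, show |(-2 : ℝ)| = 2 by norm_num]
  have hA : 0 ≤ (cos kx - cos ky) ^ 2 * |stagger kx ky| := by positivity
  have hkey : 0 ≤ |tz| * ((cos kx - cos ky) ^ 2 * |stagger kx ky|) * (1 - |cos (kz / 2)|) :=
    mul_nonneg (mul_nonneg (abs_nonneg tz) hA) (sub_nonneg.2 hc)
  nlinarith [hkey]

/-- The **`k_z`-bandwidth**: the values at `k_z = 0` and `k_z = 2π` differ by exactly `4 t_z g̃(k∥)`, so
`|E_z(k∥,0) − E_z(k∥,2π)| = 4 |t_z| g(k∥)` — the boxes' `W_z(k∥)`; together with `abs_sub_le_bandwidth` this is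
`max − min` over `k_z`. [cite: MarkiewiczEtAl2005, Eq. (7)] -/
theorem bctInterlayer_kz_zero_sub_two_pi (tz kx ky : ℝ) :
    |bctInterlayer tz kx ky 0 - bctInterlayer tz kx ky (2 * π)| = 4 * |tz| * formFactor kx ky := by
  rw [bctInterlayer_kz_zero, bctInterlayer_kz_two_pi]
  unfold formFactor dsq
  rw [show -2 * tz * (cos kx - cos ky) ^ 2 * stagger kx ky - 2 * tz * (cos kx - cos ky) ^ 2 * stagger kx ky
        = (-4) * (tz * ((cos kx - cos ky) ^ 2 * stagger kx ky)) by ring]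
  rw [abs_mul, abs_mul, abs_mul, abs_of_nonneg (sq_nonneg (cos kx - cos ky)), show |(-4 : ℝ)| = 4 by norm_num]
  ring

/-- No two `k_z` values differ by more than the bandwidth `4|t_z| g(k∥)`. [cite: MarkiewiczEtAl2005, Eq. (7)] -/
theorem abs_sub_le_bandwidth (tz kx ky kz kz' : ℝ) :
    |bctInterlayer tz kx ky kz - bctInterlayer tz kx ky kz'| ≤ 4 * |tz| * formFactor kx ky := by
  have h1 := abs_bctInterlayer_le tz kx ky kz
  have h2 := abs_bctInterlayer_le tz kx ky kz'
  calc |bctInterlayer tz kx ky kz - bctInterlayer tz kx ky kz'|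
      ≤ |bctInterlayer tz kx ky kz| + |bctInterlayer tz kx ky kz'| := abs_sub _ _
    _ ≤ 2 * |tz| * formFactor kx ky + 2 * |tz| * formFactor kx ky := add_le_add h1 h2
    _ = 4 * |tz| * formFactor kx ky := by ring

/-- Crude zone bound `g ≤ 4` (`|cos| ≤ 1`, `(cos − cos)² ≤ 4`), hence `|E_z| ≤ 8|t_z|`.
[cite: MarkiewiczEtAl2005, Eq. (7)] -/
theorem formFactor_le_four (kx ky : ℝ) : formFactor kx ky ≤ 4 := by
  unfold formFactor stagger dsq
  have h1 : |cos (kx / 2) * cos (ky / 2)| ≤ 1 := by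
    rw [abs_mul]
    exact mul_le_one₀ (abs_cos_le_one _) (abs_nonneg _) (abs_cos_le_one _)
  have hx := abs_cos_le_one kx
  have hy := abs_cos_le_one ky
  have h2 : (cos kx - cos ky) ^ 2 ≤ 4 := by
    have : |cos kx - cos ky| ≤ 2 := by
      calc |cos kx - cos ky| ≤ |cos kx| + |cos ky| := abs_sub _ _
        _ ≤ 1 + 1 := add_le_add hx hy
        _ = 2 := by ring
    nlinarith [abs_nonneg (cos kx - cos ky), sq_abs (cos kx - cos ky)]
  calc |cos (kx / 2) * cos (ky / 2)| * (cos kx - cos ky) ^ 2 ≤ 1 * 4 := by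
        gcongr
    _ = 4 := by ring

/-- `|E_z(k)| ≤ 8 |t_z|` everywhere in the zone. [cite: MarkiewiczEtAl2005, Eq. (7)] -/
theorem abs_bctInterlayer_le_eight (tz kx ky kz : ℝ) : |bctInterlayer tz kx ky kz| ≤ 8 * |tz| := by
  have h := abs_bctInterlayer_le tz kx ky kz
  have hg := formFactor_le_four kx ky
  have ht : 0 ≤ |tz| := abs_nonneg _
  nlinarith

/-! ## §2 The sharp zone maximum `64/(25√5)` of the form factor -/

/-- Half-angle form: with `u = cos(kₓ/2)`, `v = cos(k_y/2)` one has `cos kₓ = 2u² − 1`, `cos k_y = 2v² − 1`, so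
`g = 4|uv|(u² − v²)²`. [cite: MarkiewiczEtAl2005, Eq. (7)–(8)] -/
theorem formFactor_eq_halfAngle (kx ky : ℝ) :
    formFactor kx ky
      = 4 * |cos (kx / 2) * cos (ky / 2)| * (cos (kx / 2) ^ 2 - cos (ky / 2) ^ 2) ^ 2 := by
  unfold formFactor stagger dsq
  have hx : cos kx = 2 * cos (kx / 2) ^ 2 - 1 := by
    have := Real.cos_two_mul (kx / 2)
    rw [show 2 * (kx / 2) = kx by ring] at this
    exact this
  have hy : cos ky = 2 * cos (ky / 2) ^ 2 - 1 := by
    have := Real.cos_two_mul (ky / 2)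
    rw [show 2 * (ky / 2) = ky by ring] at this
    exact this
  rw [hx, hy]; ring

/-- The polynomial heart of the maximum: for `0 ≤ w` with `w² ≤ 5`, `w (5 − w²)² ≤ 16`, because
`16 − w(5 − w²)² = (w − 1)²(16 + 7w − 2w² − w³)` and the cubic factor is `≥ 6 + 2w ≥ 0` there.
[cite: MarkiewiczEtAl2005, Eq. (7)–(8)] -/
theorem aux_quintic_le (w : ℝ) (hw0 : 0 ≤ w) (hw : w ^ 2 ≤ 5) : w * (5 - w ^ 2) ^ 2 ≤ 16 := by
  have hcubic : 0 ≤ 16 + 7 * w - 2 * w ^ 2 - w ^ 3 := by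
    have h3 : w ^ 3 ≤ 5 * w := by
      have : w ^ 3 = w * w ^ 2 := by ring
      rw [this]; nlinarith
    nlinarith
  have hfac : 16 - w * (5 - w ^ 2) ^ 2 = (w - 1) ^ 2 * (16 + 7 * w - 2 * w ^ 2 - w ^ 3) := by ring
  have hsq : 0 ≤ (w - 1) ^ 2 := sq_nonneg _
  nlinarith [mul_nonneg hsq hcubic]

/-- The one-variable bound: for `0 ≤ u ≤ 1`, `4u(1 − u²)² ≤ 64/(25√5)` (substitute `w = √5·u` in
`aux_quintic_le`; equality at `u² = 1/5`). [cite: MarkiewiczEtAl2005, Eq. (7)–(8)] -/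
theorem one_var_le (u : ℝ) (hu0 : 0 ≤ u) (hu1 : u ≤ 1) :
    4 * u * (1 - u ^ 2) ^ 2 ≤ 64 / (25 * sqrt 5) := by
  have hs : 0 < sqrt 5 := Real.sqrt_pos.2 (by norm_num)
  have hs2 : sqrt 5 ^ 2 = 5 := Real.sq_sqrt (by norm_num)
  set w := sqrt 5 * u with hw
  have hw0 : 0 ≤ w := mul_nonneg hs.le hu0
  have hw5 : w ^ 2 ≤ 5 := by
    rw [hw, mul_pow, hs2]
    nlinarith
  have hq := aux_quintic_le w hw0 hw5
  -- 4u(1−u²)² = 4 w (5 − w²)² / (25 √5)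
  have hu : u = w / sqrt 5 := by rw [hw]; field_simp
  have hu2 : u ^ 2 = w ^ 2 / 5 := by rw [hw, mul_pow, hs2]; ring
  have key : 4 * u * (1 - u ^ 2) ^ 2 = 4 * (w * (5 - w ^ 2) ^ 2) / (25 * sqrt 5) := by
    rw [hu2, hu]
    field_simp
    ring
  rw [key]
  rw [div_le_div_iff_of_pos_right (by positivity)]
  linarith

/-- **The two-variable bound**: `4|uv|(u² − v²)² ≤ 64/(25√5)` for `|u|, |v| ≤ 1` (reduce to the larger of
`4|u|(1 − u²)²`, `4|v|(1 − v²)²`). [cite: MarkiewiczEtAl2005, Eq. (7)–(8)] -/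
theorem quartic_le_bound (u v : ℝ) (hu : |u| ≤ 1) (hv : |v| ≤ 1) :
    4 * |u * v| * (u ^ 2 - v ^ 2) ^ 2 ≤ 64 / (25 * sqrt 5) := by
  set a := |u| with ha
  set b := |v| with hb
  have ha0 : 0 ≤ a := abs_nonneg _
  have hb0 : 0 ≤ b := abs_nonneg _
  have hua : u ^ 2 = a ^ 2 := (sq_abs u).symm
  have hvb : v ^ 2 = b ^ 2 := (sq_abs v).symm
  rw [abs_mul, hua, hvb]
  rcases le_total a b with hab | hba
  · -- a ≤ b: 4ab(a²−b²)² ≤ 4a(1−a²)²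
    have h1 : (a ^ 2 - b ^ 2) ^ 2 ≤ (1 - a ^ 2) ^ 2 := by
      have hlo : 0 ≤ b ^ 2 - a ^ 2 := by nlinarith
      have hhi : b ^ 2 - a ^ 2 ≤ 1 - a ^ 2 := by nlinarith
      have : (a ^ 2 - b ^ 2) ^ 2 = (b ^ 2 - a ^ 2) ^ 2 := by ring
      rw [this]
      exact pow_le_pow_left₀ hlo hhi 2
    have h2 : 4 * (a * b) * (a ^ 2 - b ^ 2) ^ 2 ≤ 4 * a * (1 - a ^ 2) ^ 2 := by
      have hab1 : a * b ≤ a * 1 := by gcongr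
      have hsq : 0 ≤ (a ^ 2 - b ^ 2) ^ 2 := sq_nonneg _
      have hsq' : 0 ≤ (1 - a ^ 2) ^ 2 := sq_nonneg _
      calc 4 * (a * b) * (a ^ 2 - b ^ 2) ^ 2 ≤ 4 * (a * 1) * (a ^ 2 - b ^ 2) ^ 2 := by gcongr
        _ ≤ 4 * (a * 1) * (1 - a ^ 2) ^ 2 := by gcongr
        _ = 4 * a * (1 - a ^ 2) ^ 2 := by ring
    exact h2.trans (one_var_le a ha0 hu)
  · -- b ≤ a: symmetric
    have h1 : (a ^ 2 - b ^ 2) ^ 2 ≤ (1 - b ^ 2) ^ 2 := by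
      have hlo : 0 ≤ a ^ 2 - b ^ 2 := by nlinarith
      have hhi : a ^ 2 - b ^ 2 ≤ 1 - b ^ 2 := by nlinarith
      exact pow_le_pow_left₀ hlo hhi 2
    have h2 : 4 * (a * b) * (a ^ 2 - b ^ 2) ^ 2 ≤ 4 * b * (1 - b ^ 2) ^ 2 := by
      have hsq : 0 ≤ (a ^ 2 - b ^ 2) ^ 2 := sq_nonneg _
      calc 4 * (a * b) * (a ^ 2 - b ^ 2) ^ 2 ≤ 4 * (1 * b) * (a ^ 2 - b ^ 2) ^ 2 := by gcongr
        _ ≤ 4 * (1 * b) * (1 - b ^ 2) ^ 2 := by gcongr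
        _ = 4 * b * (1 - b ^ 2) ^ 2 := by ring
    exact h2.trans (one_var_le b hb0 hv)

/-- The zone-maximum constant `64/(25√5)` of the form factor. [cite: MarkiewiczEtAl2005, Eq. (7)–(8)] -/
def bzMaxConst : ℝ := 64 / (25 * sqrt 5)

/-- **The form factor never exceeds `64/(25√5) ≈ 1.14487`** anywhere in the zone — so the BZ-maximum of the
boxes' `W_z(k∥)/4t` object is `(64/(25√5))·|t_z/t|`. [cite: MarkiewiczEtAl2005, Eq. (7)–(8)] -/
theorem formFactor_le (kx ky : ℝ) : formFactor kx ky ≤ bzMaxConst := by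
  rw [formFactor_eq_halfAngle]
  exact quartic_le_bound _ _ (abs_cos_le_one _) (abs_cos_le_one _)

/-- **Sharpness**: the maximum is ATTAINED on the `(k, 0)` line at `cos(kₓ/2) = 1/√5` (i.e. `cos kₓ = −3/5`).
[cite: MarkiewiczEtAl2005, Eq. (7)–(8)] -/
theorem formFactor_sharp : formFactor (2 * arccos (1 / sqrt 5)) 0 = bzMaxConst := by
  rw [formFactor_eq_halfAngle]
  have hs : 0 < sqrt 5 := Real.sqrt_pos.2 (by norm_num)
  have hs2 : sqrt 5 ^ 2 = 5 := Real.sq_sqrt (by norm_num)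
  have hs1 : 1 ≤ sqrt 5 := by
    rw [show (1:ℝ) = sqrt 1 by simp]
    exact Real.sqrt_le_sqrt (by norm_num)
  have hle : 1 / sqrt 5 ≤ 1 := by
    rw [div_le_one hs]; exact hs1
  have hge : -1 ≤ 1 / sqrt 5 := by
    have : 0 ≤ 1 / sqrt 5 := by positivity
    linarith
  have hc : cos (2 * arccos (1 / sqrt 5) / 2) = 1 / sqrt 5 := by
    rw [show 2 * arccos (1 / sqrt 5) / 2 = arccos (1 / sqrt 5) by ring]
    exact Real.cos_arccos hge hle
  rw [hc]
  simp only [zero_div, Real.cos_zero, mul_one, one_pow]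
  rw [abs_of_nonneg (by positivity)]
  unfold bzMaxConst
  field_simp
  nlinarith [hs2, hs]

/-- `2.2360679 < √5 < 2.2360680`. [cite: MohrEtAl2025, e-print p. 45 (arithmetic only)] -/
theorem sqrt5_bracket : 2.2360679 < sqrt 5 ∧ sqrt 5 < 2.2360680 := by
  constructor
  · rw [Real.lt_sqrt (by norm_num)]; norm_num
  · rw [Real.sqrt_lt' (by norm_num)]; norm_num

/-- **Bracket** `1.1448 < 64/(25√5) < 1.1449`. [cite: MarkiewiczEtAl2005, Eq. (7)–(8) (arithmetic)] -/
theorem bzMaxConst_bracket : 1.1448 < bzMaxConst ∧ bzMaxConst < 1.1449 := by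
  obtain ⟨h1, h2⟩ := sqrt5_bracket
  have hs : 0 < sqrt 5 := Real.sqrt_pos.2 (by norm_num)
  unfold bzMaxConst
  constructor
  · rw [lt_div_iff₀ (by positivity)]; nlinarith
  · rw [div_lt_iff₀ (by positivity)]; nlinarith

/-- The BZ-maximum image `W_z,max/4t = (64/(25√5))·r` of an amplitude ratio `r = |t_z/t|`.
[cite: MarkiewiczEtAl2005, Eq. (7)–(8)] -/
def bzMaxImage (r : ℝ) : ℝ := bzMaxConst * r

/-- `bzMaxImage` is monotone in `r`. [cite: MarkiewiczEtAl2005, Eq. (7)–(8)] -/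
theorem bzMaxImage_mono {r s : ℝ} (h : r ≤ s) : bzMaxImage r ≤ bzMaxImage s := by
  unfold bzMaxImage
  have : 0 ≤ bzMaxConst := by have := bzMaxConst_bracket; linarith [this.1]
  exact mul_le_mul_of_nonneg_left h this

/-! ## §3 CODATA arithmetic for the quantum-oscillation members -/

/-- The Landau-level spacing `ħω_c = ħeB/m* = 2 μ_B B /(m*/m_e)` in eV (`μ_B = eħ/2m_e`), for `B` in tesla and
the mass ratio `m*/m_e`. [cite: KartsovnikEtAl2011NCCOFermiSurface, p. 14 (ω_c = eB/m_c); MohrEtAl2025, p. 45 (μ_B)] -/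
def cyclotronQuantum (B mratio : ℝ) : ℝ := 2 * muB * B / mratio

/-- **NCCO reading made numeric**: `2.516 meV < ħω_c(20 T, m_c = 0.92 m_e) < 2.518 meV` — the printed sentence
"ħω_c … exceeds the interlayer dispersion at fields B ≳ 20 T" thus bounds the inter-layer dispersion of the
x = 0.16 pocket by ≈ 2.5 meV. [cite: KartsovnikEtAl2011NCCOFermiSurface, pp. 14–15 (no beating; m_c/m_e = 0.92 ± 0.05)] -/
theorem ncco_cyclotronQuantum_20T :
    2.516e-3 < cyclotronQuantum 20 0.92 ∧ cyclotronQuantum 20 0.92 < 2.518e-3 := by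
  unfold cyclotronQuantum muB
  constructor <;> norm_num

/-- Chan–Harrison et al.'s warping dictionary `2ΔF_c ≈ 4 t⊥ m*/(ħe)` solved for the hopping:
`t⊥ = ħe·2ΔF_c/(4m*) = μ_B ΔF_c/(m*/m_e)` in eV (`ΔF_c` in tesla). [cite: ChanEtAl2016Hg1201SinglePocket, Methods (R_w = J₀(2πΔF_c/B), 2ΔF_c ≈ 4t⊥m*/(ħe))] -/
def warpingHopping (dFc mratio : ℝ) : ℝ := muB * dFc / mratio

/-- The dictionary identity `4 · t⊥ · (m*/m_e) = 2 μ_B · (2ΔF_c)` (i.e. `2ΔF_c = 4 t⊥ m*/(ħe)` with `ħe/m_e = 2μ_B`),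
for `m*/m_e ≠ 0`. [cite: ChanEtAl2016Hg1201SinglePocket, Methods] -/
theorem warpingHopping_dictionary (dFc mratio : ℝ) (hm : mratio ≠ 0) :
    4 * warpingHopping dFc mratio * mratio = 2 * muB * (2 * dFc) := by
  unfold warpingHopping; field_simp; ring

/-- **Hg-1201 re-derivation**: with `ΔF_c < 16 T` and `m* ≈ 2.7 m_e` the printed bound "t⊥ < 0.35 meV" is
`μ_B·16/2.7 ∈ (0.3430, 0.3431) meV`. [cite: ChanEtAl2016Hg1201SinglePocket, p. 3 ("ΔF_c < 16 T … t⊥ < 0.35 meV")] -/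
theorem hg1201_warpingHopping_bracket :
    3.430e-4 < warpingHopping 16 2.7 ∧ warpingHopping 16 2.7 < 3.431e-4 := by
  unfold warpingHopping muB
  constructor <;> norm_num

/-- … hence below the printed `0.35 meV`. [cite: ChanEtAl2016Hg1201SinglePocket, p. 3] -/
theorem hg1201_warpingHopping_lt : warpingHopping 16 2.7 < 3.5e-4 := by
  have := hg1201_warpingHopping_bracket; linarith [this.2]

/-- `warpingHopping` is monotone in `ΔF_c` at positive mass ratio — so `ΔF_c < 16 T` gives `t⊥ < t⊥(16 T)`.
[cite: ChanEtAl2016Hg1201SinglePocket, Methods] -/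
theorem warpingHopping_mono {d d' : ℝ} (mratio : ℝ) (hm : 0 < mratio) (h : d ≤ d') :
    warpingHopping d mratio ≤ warpingHopping d' mratio := by
  unfold warpingHopping
  exact div_le_div_of_nonneg_right (mul_le_mul_of_nonneg_left h muB_pos.le) hm.le

/-- "at least 1000 times smaller than the nearest neighbor hopping (t = 460 meV)": `t⊥(16 T, 2.7)/0.460 eV < 10⁻³`.
[cite: ChanEtAl2016Hg1201SinglePocket, p. 3] -/
theorem hg1201_ratio_lt : warpingHopping 16 2.7 / 0.460 < 1e-3 := by
  have := hg1201_warpingHopping_bracket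
  rw [div_lt_iff₀ (by norm_num)]; linarith [this.2]

/-- "25 times smaller than the bare value determined from LDA calculations (t⊥ = 10 meV)":
`25 · t⊥(16 T, 2.7) < 10 meV`. [cite: ChanEtAl2016Hg1201SinglePocket, p. 3] -/
theorem hg1201_lda_ratio : 25 * warpingHopping 16 2.7 < 10e-3 := by
  have := hg1201_warpingHopping_bracket; linarith [this.2]

/-! ## §4 The located La-214 / Tl-2201 members and their images; the κ-(ET)₂Cu(NCS)₂ isotope pair -/

/-- SX-ARPES inter-layer amplitude of La₁.₇₈Sr₀.₂₂CuO₄ and La₁.₅₉Eu₀.₂Sr₀.₂₁CuO₄: `t_z = 0.07 t` (12 K).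
[cite: HorioEtAl2018LSCO3DFermiSurface, Table I] -/
def horio18_tz : ℝ := 0.07

/-- SX-ARPES bound for Tl₂Ba₂CuO₆₊δ (T_c = 20 K): `t_z/t < 0.015`. [cite: HorioEtAl2018LSCO3DFermiSurface, Table I] -/
def horio18_tz_Tl2201_bound : ℝ := 0.015

/-- ADMR inter-layer amplitude of La₁.₆₋ₓNd₀.₄SrₓCuO₄, `p = 0.24`: `t_z/t = 0.0651 ± 0.0005`.
[cite: GrissonnancheEtAl2021PlanckianADMR, Extended Data Table 1] -/
def admr_tz : ℝ := 0.0651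

/-- Its printed error bar `± 0.0005`. [cite: GrissonnancheEtAl2021PlanckianADMR, Extended Data Table 1] -/
def admr_tz_err : ℝ := 0.0005

/-- LDA tight-binding inter-layer amplitude of La₂₋ₓSrₓCuO₄: `t_z/t = 0.12` (Eq. (7) fit; `0.125` with Eq. (24)).
[cite: MarkiewiczEtAl2005, §IV A ("tz/t = 0.12") and Table I (t_z = 50 meV, t = 430 meV)] -/
def lda_tz : ℝ := 0.12

/-- **Measured/bare on the inter-layer coordinate**: `0.54 < 0.0651/0.12` and `0.07/0.12 < 0.59` — the "1.7 times
larger" DFT value of the source. [cite: HorioEtAl2018LSCO3DFermiSurface, p. 4 ("this value of t_z is 1.7 times larger than what is found by our experiment")] -/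
theorem la214_measured_over_bare :
    0.54 < admr_tz / lda_tz ∧ horio18_tz / lda_tz < 0.59 ∧
      1.7 < lda_tz / horio18_tz ∧ lda_tz / horio18_tz < 1.72 := by
  unfold admr_tz lda_tz horio18_tz
  refine ⟨?_, ?_, ?_, ?_⟩ <;> norm_num

/-- The ADMR and ARPES members AGREE within the ARPES error bar `± 0.02 t`: `|0.07 − 0.0651| < 0.02`.
[cite: GrissonnancheEtAl2021PlanckianADMR, Methods ("a 7% deviation at most for t_z"; ARPES error bar ± 0.02t)] -/
theorem admr_arpes_agree : |horio18_tz - admr_tz| < 0.02 ∧ |horio18_tz - admr_tz| / admr_tz < 0.08 := by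
  unfold horio18_tz admr_tz
  constructor
  · rw [abs_of_nonneg (by norm_num)]; norm_num
  · rw [abs_of_nonneg (by norm_num)]; norm_num

/-- **BZ-maximum images** of the three La-214 members and the Tl-2201 bound:
`0.0745 < img(0.0651) < 0.0746`, `0.0801 < img(0.07) < 0.0802`, `0.1373 < img(0.12) < 0.1374`,
`img(0.015) < 0.0172`. [cite: MarkiewiczEtAl2005, Eq. (7)–(8); HorioEtAl2018LSCO3DFermiSurface, Table I] -/
theorem bzMaxImage_members :
    (0.0745 < bzMaxImage admr_tz ∧ bzMaxImage admr_tz < 0.0746) ∧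
    (0.0801 < bzMaxImage horio18_tz ∧ bzMaxImage horio18_tz < 0.0802) ∧
    (0.1373 < bzMaxImage lda_tz ∧ bzMaxImage lda_tz < 0.1374) ∧
    bzMaxImage horio18_tz_Tl2201_bound < 0.0172 := by
  obtain ⟨h1, h2⟩ := bzMaxConst_bracket
  unfold bzMaxImage admr_tz horio18_tz lda_tz horio18_tz_Tl2201_bound
  refine ⟨⟨?_, ?_⟩, ⟨?_, ?_⟩, ⟨?_, ?_⟩, ?_⟩ <;> nlinarith

/-- For ANY zone momentum the inter-layer bandwidth object `W_z(k∥)/4|t|` with the measured ARPES amplitude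
`|t_z| = 0.07|t|` is below `0.0802` (and a fortiori so is every FS-average). [cite: HorioEtAl2018LSCO3DFermiSurface, Table I] -/
theorem bandwidth_object_le_arpes (t kx ky : ℝ) (ht : 0 < t) :
    |bctInterlayer (horio18_tz * t) kx ky 0 - bctInterlayer (horio18_tz * t) kx ky (2 * π)| / (4 * t)
      < 0.0802 := by
  rw [bctInterlayer_kz_zero_sub_two_pi]
  have hg := formFactor_le kx ky
  have hg0 := formFactor_nonneg kx ky
  obtain ⟨_, h2⟩ := bzMaxConst_bracket
  have habs : |horio18_tz * t| = horio18_tz * t := abs_of_pos (by unfold horio18_tz; positivity)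
  rw [habs, div_lt_iff₀ (by positivity)]
  unfold horio18_tz at *
  nlinarith [mul_le_mul_of_nonneg_left hg (by positivity : (0:ℝ) ≤ 4 * (0.07 * t))]

/-- κ-(BEDT-TTF)₂Cu(NCS)₂ inter-layer transfer integrals by isotope (AMRO peak width, 42 T, 0.5 K):
`t_a(h8) = 0.065 ± 0.007 meV`. [cite: GoddardEtAl2004KappaNCSAMRO, Fig. 16 caption] -/
def goddard04_ta_h8 : ℝ := 0.065
/-- its error bar. [cite: GoddardEtAl2004KappaNCSAMRO, Fig. 16 caption] -/
def goddard04_ta_h8_err : ℝ := 0.007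
/-- `t_a(d8) = 0.045 ± 0.005 meV`. [cite: GoddardEtAl2004KappaNCSAMRO, Fig. 16 caption and §V] -/
def goddard04_ta_d8 : ℝ := 0.045
/-- its error bar. [cite: GoddardEtAl2004KappaNCSAMRO, §V] -/
def goddard04_ta_d8_err : ℝ := 0.005
/-- dressed in-plane `t_c1 = 26.65 meV` of the effective dimer model (from magnetic quantum oscillations).
[cite: GoddardEtAl2004KappaNCSAMRO, §II (t_b = 14.87, t_c1 = 26.65, t_c2 = 22.75 meV, E_F = −19.12 meV)] -/
def goddard04_tc1 : ℝ := 26.65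

/-- **Isotope ratio, worst case under the printed error bars**: `1.16 ≤ (0.065 − 0.007)/(0.045 + 0.005)` and
`(0.065 + 0.007)/(0.045 − 0.005) ≤ 1.8`; central `1.44 < 0.065/0.045 < 1.45`; and the inter- to intra-layer ratio
`2.4e-3 < t_a(h8)/t_c1 < 2.5e-3`. [cite: GoddardEtAl2004KappaNCSAMRO, Fig. 16 and §II] -/
theorem kappaNCS_isotope_ratio :
    1.16 ≤ (goddard04_ta_h8 - goddard04_ta_h8_err) / (goddard04_ta_d8 + goddard04_ta_d8_err) ∧
    (goddard04_ta_h8 + goddard04_ta_h8_err) / (goddard04_ta_d8 - goddard04_ta_d8_err) ≤ 1.8 ∧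
    (1.44 < goddard04_ta_h8 / goddard04_ta_d8 ∧ goddard04_ta_h8 / goddard04_ta_d8 < 1.45) ∧
    (2.4e-3 < goddard04_ta_h8 / goddard04_tc1 ∧ goddard04_ta_h8 / goddard04_tc1 < 2.5e-3) := by
  unfold goddard04_ta_h8 goddard04_ta_h8_err goddard04_ta_d8 goddard04_ta_d8_err goddard04_tc1
  refine ⟨?_, ?_, ⟨?_, ?_⟩, ⟨?_, ?_⟩⟩ <;> norm_num

end

end Literature.MathematicalPhysics.QuantumLattice.BctInterlayer
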